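import Summits.AtomisticToContinuum.HydrodynamicLimit.Theses.StrongClosureWeakBV
import Literature.Analysis.PDE.ConservationLawWeakStrongUniqueness

/-!
# Birth skeleton of the crux `WeakStrongUniquenessHS3D` (stmt-AtomisticToContinuum-9399)

Route `route-AtomisticToContinuum-StrongClosureWeakBV`, crux decl
`Summit.AtomisticToContinuum.HydrodynamicLimit.Theses.StrongClosureWeakBV.WeakStrongUniquenessHS3D`
(Dafermos–DiPerna weak–strong uniqueness for the hard-sphere Euler system on `𝕋³`: `∃ η₀ > 0 ∀ σ > 0
∀ box (m, M) ∀ T`, a classical solution `(ρ,u,θ)` (`IsHardSphereEulerSolution σ T`) valued in the box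
with packing `ρσ³ ≤ η₀` and a bounded measurable weak ENTROPY solution `(ρ',u',θ')` (inline χ-weak
formulation on the torus: mass, three momentum components, energy, ONE entropy inequality for
`H = −ρs`, `L¹`-right-continuity in time) in the same box with the same `t = 0` slice a.e. agree a.e.
at every `t ∈ [0,T)`).
Skeleton registrar `planner-skel-stmt-AtomisticToContinuum-9399-0`, 2026-08-17 (BC3 birth certificate;
route re-audit bin REPAIRABLE).

THE LINE = INSTANTIATE THE TREE'S DAFERMOS THEOREM. The generic theorem is PROVED in the tree:
`Literature.Analysis.PDE.ConservationLaw.dafermos_weak_strong_uniqueness_holds`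
(`ConservationLawWeakStrongUniqueness.lean`, Dafermos 2000 Thm 5.2.1 "In particular", for systems
`∂ₜU + Σ_α ∂_α G_α(U) = 0` on `ℝ^m` endowed with a uniformly convex entropy pair
(`IsConvexEntropySystem`), classical (`IsClassicalSolution`) vs admissible weak
(`IsWeakSolution` + `IsEntropyAdmissible`) solutions valued in a convex compact `𝒟 ⊆ 𝒪`; conclusion:
equality a.e. on `(0,T) × ℝ^m`), and the low-density equation of state is PROVED
(`Theorems.hsEosLowDensity_proof`: `f_ex` is real-analytic on `[0, η₀)`). What remains — and what the
grounders named as the content of this item (g17-11: "take `dafermos_weak_strong_uniqueness` and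
discharge the instantiation (a)–(d)") — is exactly four pieces of DIFFERENT mathematics, none of which
is the crux or the Statement:

* `stub_entropyStructure` (S1, thermodynamics / convex analysis, size M–L): at low packing the
  hard-sphere Euler system written in conserved variables `U = (ρ, m, E) ∈ ℝ⁵` with fluxes `hsFlux`,
  entropy `hsEntropy = −ρs` and entropy flux `hsEntropyFlux = −ρs m/ρ` IS a Dafermos system
  (`IsConvexEntropySystem`: open state domain, `C^∞` data, the compatibility `Dq_α = Dη DG_α`, `D²η`
  positive definite uniformly on compacts) on an open set containing a convex compact `D` containing
  the conserved image `consBox` of every dilute primitive box.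
* `stub_classicalLift` (S2, calculus, size M): the periodic lift `slabLift` of a boxed classical
  hard-sphere Euler solution (`IsHardSphereEulerSolution σ T`, `0 < T`) to `[0,T) × ℝ³` is an
  `IsClassicalSolution` of that system (weak form on `ℝ³` by integration by parts of the pointwise
  torus equations rewritten in conserved form; local Lipschitz from joint smoothness).
* `stub_weakLift` (S3, THE HEART, periodisation + density, size L): the periodic lift of the crux's
  inline torus weak entropy solution, boxed, with `t = 0` slice a.e. equal to the classical datum, is
  an `IsWeakSolution` AND `IsEntropyAdmissible` on `ℝ³` with the classical datum (periodise `C¹_c`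
  test functions on `ℝ × ℝ³`, approximate them by `C^∞` ones in `C¹`, unfold the torus measure as
  Lebesgue measure on a fundamental domain, match the five components and the entropy inequality).
* `stub_readout` (S4, measure theory, size M): equality of the two lifts a.e. on `(0,T) × ℝ³` gives,
  through Fubini, the covering map `ℝ³ → 𝕋³`, the `L¹`-right-continuity in time of both solutions and
  the inversion `(ρ, ρu, E) ↦ (ρ, u, θ)` on `ρ ≥ m > 0`, equality of the primitive fields a.e. on `𝕋³`
  at EVERY `t ∈ [0,T)`.
* Composition `WeakStrongUniquenessHS3D_of : S1 → S2 → S3 → S4 → WeakStrongUniquenessHS3D`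
  (sorry-free): `η₀ := η₁` of S1; given the crux's data and `t ∈ [0,T)` (whence `0 < T`, the positive
  horizon the lifts need — the empty-horizon corner that refuted `GeneralStrongClosure`, stmt-9395, is
  vacuous here), S1 gives `O ⊇ D ⊇ consBox`, S2/S3 the three solution predicates, the box gives values
  in `D`, the TREE THEOREM `dafermos_weak_strong_uniqueness_holds 3 5 …` gives a.e. equality of the
  lifts on `(0,T) × ℝ³`, and S4 reads the crux's conclusion off it.

Every `def` of §0 is either VERBATIM a `let` / hypothesis block of the crux (`W3`, `TorusWeakEntropySol`,
`TimeL1Cont`, `WeakEntropySol`, `InBox`) — so the composition type-checks against the crux by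
definitional unfolding only — or the conserved-variable dictionary of the instantiation (`cons`,
`dens`, `mom`, `ener`, `temp`, `hsEntropy`, `hsFlux`, `hsEntropyFlux`, `consBox`, `slabLift`).

Disproof used: none exists for this crux at registration (`ledger crux ls stmt-AtomisticToContinuum-9399`:
no workfiles, 2026-08-17). Negative knowledge honoured: (i) the negatives index
(`ledger negatives --problem AtomisticToContinuum`, 20 entries) has no deterministic PDE / weak–strong
statement; the one entry of this route, `GeneralStrongClosure` (stmt-9395, refuted-misstated at the EMPTY
horizon `T ≤ 0`), is why S2/S3 carry `0 < T` explicitly and S4 is vacuous at `T ≤ 0`; (ii) the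
Literature refutation `ConservationLaw.not_dafermos_weak_strong_stability` (the misstated `L²`-stability
display) is avoided — the composition uses only the PROVED uniqueness clause
`dafermos_weak_strong_uniqueness_holds`, never the deprecated stability `def`.
-/

noncomputable section

open MeasureTheory Filter Set
open scoped Topology Classical

namespace Summit.AtomisticToContinuum.HydrodynamicLimit.Cruxes.WeakStrongUniquenessHS3D.Birth

open Literature.MathematicalPhysics.KineticTheory
open Literature.Analysis.FunctionSpaces
open Literature.Analysis.PDE.ConservationLaw
open Summit.AtomisticToContinuum.HydrodynamicLimit.Theses

-- §0-BEGIN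
/-! ## §0 Objects of the line

Part A — verbatim the `let`s and hypothesis blocks of the crux; Part B — the conserved-variable
dictionary `(ρ, u, θ) ↦ U = (ρ, ρu, E) ∈ ℝ⁵` through which the tree's Dafermos theorem is instantiated. -/

/-- Conserved states `U = (ρ, m₁, m₂, m₃, E) ∈ ℝ⁵` (the `EuclideanSpace ℝ (Fin n)`, `n = 5`, of the
tree's `ConservationLaw` vocabulary). -/
abbrev E5 : Type := EuclideanSpace ℝ (Fin 5)

/-- Physical space `ℝ³` covering `𝕋³` (the `EuclideanSpace ℝ (Fin m)`, `m = 3`). -/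
abbrev E3 : Type := EuclideanSpace ℝ (Fin 3)

/-- The weak pairing with initial term, `∫_{t>0}∫_{𝕋³} (a ∂ₜφ + ⟪F, ∇φ⟫) + ∫_{𝕋³} a(0) φ(0)` — VERBATIM
the `W3` of the crux. -/
def W3 (a : ℝ → T3 → ℝ) (F : ℝ → T3 → V3) (φ : ℝ → T3 → ℝ) : ℝ :=
  (∫ t in Set.Ioi 0, ∫ x, (a t x * Torus.timeDeriv φ t x + inner ℝ (F t x) (Torus.gradient (φ t) x))) +
    ∫ x, a 0 x * φ 0 x

/-- The χ-weak hard-sphere Euler system with ONE entropy inequality on `[0,T) × 𝕋³` (mass, the three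
momentum components, energy, and `∂ₜH + div(Hu) ≤ 0` for `H = −ρs = −ρ(3/2 log θ − log ρ − f_ex(ρσ³))`,
tested against smooth `φ` vanishing for `t ≥ T' < T`) — VERBATIM the fourth conjunct of the `S3` block
of the crux (with its `let`s `E`, `p`, `H`). -/
def TorusWeakEntropySol (σ T : ℝ) (ρ θ : ℝ → T3 → ℝ) (u : ℝ → T3 → V3) : Prop :=
  let E := fun (t : ℝ) (x : T3) => totalEnergyDensity (ρ t x) (u t x) (θ t x)
  let p := fun (t : ℝ) (x : T3) => hsPressure σ (ρ t x) (θ t x)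
  let H := fun (t : ℝ) (x : T3) =>
    -(ρ t x * (3 / 2 * Real.log (θ t x) - Real.log (ρ t x) - hsExcessFreeEnergy (ρ t x * σ ^ 3)))
  ∀ φ : ℝ → T3 → ℝ, ContDiff ℝ (⊤ : ℕ∞) (Torus.stLift φ) → (∃ T' < T, ∀ t, T' ≤ t → ∀ x, φ t x = 0) →
    W3 ρ (fun t x => ρ t x • u t x) φ = 0 ∧
    (∀ i : Fin 3, W3 (fun t x => ρ t x * u t x i)
      (fun t x => (ρ t x * u t x i) • u t x + p t x • EuclideanSpace.single i (1 : ℝ)) φ = 0) ∧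
    W3 E (fun t x => (E t x + p t x) • u t x) φ = 0 ∧
    ((∀ t x, 0 ≤ φ t x) → 0 ≤ W3 H (fun t x => H t x • u t x) φ)

/-- `L¹(𝕋³)`-continuity in time within `[0,T)` of the primitive triple — VERBATIM the third conjunct
of the `S3` block of the crux. -/
def TimeL1Cont (T : ℝ) (ρ θ : ℝ → T3 → ℝ) (u : ℝ → T3 → V3) : Prop :=
  ∀ t ∈ Set.Ico 0 T, Filter.Tendsto (fun s : ℝ => ∫ x, dist (ρ s x, u s x, θ s x) (ρ t x, u t x, θ t x))
    (nhdsWithin t (Set.Ico 0 T)) (nhds 0)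

/-- The crux's competitor class — VERBATIM the `S3` block of the crux: jointly measurable,
`L¹`-time-continuous, weak entropy solution. (Only used to certify the definitional match; the stubs
take its four conjuncts separately.) -/
def WeakEntropySol (σ T : ℝ) (ρ θ : ℝ → T3 → ℝ) (u : ℝ → T3 → V3) : Prop :=
  (∀ f ∈ [ρ, θ], Measurable (Function.uncurry f)) ∧ Measurable (Function.uncurry u) ∧
    TimeL1Cont T ρ θ u ∧ TorusWeakEntropySol σ T ρ θ u

/-- The primitive box with packing bound: `m ≤ ρ, θ ≤ M`, `|u| ≤ M`, `ρσ³ ≤ η` on `[0,T) × 𝕋³` —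
VERBATIM the `B3` block of the crux. -/
def InBox (σ η m M T : ℝ) (ρ θ : ℝ → T3 → ℝ) (u : ℝ → T3 → V3) : Prop :=
  ∀ t ∈ Set.Ico 0 T, ∀ x,
    m ≤ ρ t x ∧ ρ t x ≤ M ∧ m ≤ θ t x ∧ θ t x ≤ M ∧ ‖u t x‖ ≤ M ∧ ρ t x * σ ^ 3 ≤ η

/-- The conserved state of a primitive triple: `cons ρ u θ = (ρ, ρu, E)`, `E = ρ(|u|²/2 + 3θ/2)`. -/
def cons (r : ℝ) (w : V3) (ϑ : ℝ) : E5 :=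
  WithLp.toLp 2 ![r, r * w 0, r * w 1, r * w 2, totalEnergyDensity r w ϑ]

/-- Density coordinate `ρ = U₀`. -/
def dens (V : E5) : ℝ := V 0

/-- Momentum coordinates `m = (U₁, U₂, U₃)`. -/
def mom (V : E5) : V3 := WithLp.toLp 2 ![V 1, V 2, V 3]

/-- Total energy coordinate `E = U₄`. -/
def ener (V : E5) : ℝ := V 4

/-- Temperature of a conserved state, `θ(U) = ⅔ (E/ρ − |m|²/(2ρ²))` (so `θ(cons ρ u θ) = θ` for
`ρ ≠ 0`; the same expression as in the route's `HsEntropyConvex`). -/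
def temp (V : E5) : ℝ := 2 / 3 * (ener V / dens V - ‖mom V‖ ^ 2 / (2 * dens V ^ 2))

/-- The hard-sphere entropy in conserved variables, `η_σ(U) = −ρ s = −ρ(3/2 log θ(U) − log ρ −
f_ex(ρσ³))` (at `U = cons ρ' u' θ'`, `ρ' ≠ 0`, literally the `H` of the crux). -/
def hsEntropy (σ : ℝ) (V : E5) : ℝ :=
  -(dens V * (3 / 2 * Real.log (temp V) - Real.log (dens V) - hsExcessFreeEnergy (dens V * σ ^ 3)))

/-- The hard-sphere Euler fluxes in conserved variables,
`G_α(U) = (m_α, (m_α/ρ) m + p e_α, (E + p) m_α/ρ)`, `p = hsPressure σ ρ θ(U) = ρθZ(ρσ³)`. -/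
def hsFlux (σ : ℝ) (α : Fin 3) (V : E5) : E5 :=
  let p := hsPressure σ (dens V) (temp V)
  WithLp.toLp 2 ![mom V α,
    mom V α / dens V * mom V 0 + (if α = 0 then p else 0),
    mom V α / dens V * mom V 1 + (if α = 1 then p else 0),
    mom V α / dens V * mom V 2 + (if α = 2 then p else 0),
    (ener V + p) * mom V α / dens V]

/-- The entropy flux `q_α(U) = η_σ(U) m_α/ρ = −ρ s u_α` (at `cons ρ' u' θ'` literally `H u'_α`). -/
def hsEntropyFlux (σ : ℝ) (α : Fin 3) (V : E5) : ℝ := hsEntropy σ V * mom V α / dens V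

/-- The conserved image of the primitive box: `{cons ρ u θ | m ≤ ρ ≤ M, m ≤ θ ≤ M, |u| ≤ M, ρσ³ ≤ η}`
(the constraint is literally the body of `InBox`). -/
def consBox (σ η m M : ℝ) : Set E5 :=
  {V | ∃ (r : ℝ) (w : V3) (ϑ : ℝ),
    (m ≤ r ∧ r ≤ M ∧ m ≤ ϑ ∧ ϑ ≤ M ∧ ‖w‖ ≤ M ∧ r * σ ^ 3 ≤ η) ∧ V = cons r w ϑ}

/-- The periodic lift of a primitive triple on `[0,T) × 𝕋³` to a conserved field on `ℝ × ℝ³`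
(time first, as in the tree's `ConservationLaw` vocabulary): `(t, y) ↦ cons (ρ, u, θ)(t, proj y)` for
`t ∈ [0,T)`, frozen at its `t = 0` slice outside `[0,T)` (the crux constrains nothing there; the
freeze keeps the lift measurable and makes `slabLift T ρ θ u 0` the `t = 0` datum for every `T`). -/
def slabLift (T : ℝ) (ρ θ : ℝ → T3 → ℝ) (u : ℝ → T3 → V3) : ℝ → E3 → E5 :=
  fun t y => if t ∈ Set.Ico 0 T then cons (ρ t (Torus.proj y)) (u t (Torus.proj y)) (θ t (Torus.proj y))
    else cons (ρ 0 (Torus.proj y)) (u 0 (Torus.proj y)) (θ 0 (Torus.proj y))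

/-! ## §1 Stub signatures

Each stub's statement is the `Prop` `Sig.stub_<name>`; the registered obligation is
`theorem stub_<name> : Sig.stub_<name> := by sorry` (§2); the composition
`WeakStrongUniquenessHS3D_of` takes the four signatures as hypotheses BY NAME. -/

/-- **S1 — the hard-sphere Euler system at low packing is a Dafermos convex-entropy system around
every dilute box (thermodynamics; size M–L).** There is `η₁ > 0` such that for every `σ > 0` and every
box `0 < m, M`: some OPEN `O ⊆ ℝ⁵` carries `IsConvexEntropySystem O (hsFlux σ) (hsEntropy σ)
(hsEntropyFlux σ)` (fluxes, entropy, entropy flux `C^∞` on `O`; `Dq_α = Dη ∘ DG_α` on `O`; `D²η ≥ c_K > 0`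
on every compact `K ⊆ O`) and contains a convex compact `D ⊇ consBox σ η₁ m M`. Why plausibly true:
take `O = {ρ > 0, ρσ³ < 2η₁, |m|² < 2ρE}` (open, CONVEX — `|m|²/(2ρ)` is a perspective function — and
`θ(U) > 0` on it) with `2η₁` below the analyticity threshold of `Theorems.hsEosLowDensity_proof`, so
`f_ex`, `Z = 1 + ηf_ex'` and hence `G, η, q` are `C^∞` on `O`; the compatibility is the Gibbs relation
`θ ds = de + p d(1/ρ)` for `s = 3/2 log θ − log ρ − f_ex(ρσ³)`, `e = 3θ/2`, which holds EXACTLY with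
`p = ρθ(1 + ηf_ex'(η)) = hsPressure` (so `(−ρs, −ρsu)` is an entropy pair, Dafermos §3.3); `D²η` is the
positive definite ideal-gas Hessian of `−ρ(3/2 log θ − log ρ)` (Harten; `γ = 5/3`) plus the rank-one
`σ³(2f_ex' + ηf_ex'')(dρ)²`, nonnegative for `η ≤ 2η₁` small since `f_ex'(0) = 2π/3 > 0`; positive
definiteness is uniform on compacts by continuity; `D :=` the convex hull of the compact `consBox`
(inside the convex `O` because `ρ ≥ m > 0`, `ρσ³ ≤ η₁ < 2η₁`, `θ ≥ m > 0`), compact by Carathéodory.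
Why it might fail: only by a slip in the dictionary — a wrong entry of `hsFlux`/`hsEntropyFlux` breaks
`Dq_α = Dη DG_α` identically (cheapest falsifier: the symbolic 5×5 check at `f_ex = 0`), and `η₁` must
sit inside BOTH the analyticity radius and the range where `2f_ex' + ηf_ex'' ≥ 0`. Leans on:
`Theorems.hsEosLowDensity_proof` (PROVED: `HsEosLowDensity`), `IsConvexEntropySystem`,
`JaynesSqueezeBlockGibbsToRelEntropyEntropyConservation.contDiffOn_pressure_band`-type smoothness
lemmas, Mathlib `convexHull`, `ContDiffOn.euclideanSpace`-style componentwise smoothness,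
`iteratedFDeriv_two_apply`. -/
def Sig.stub_entropyStructure : Prop :=
  ∃ η₁ > (0 : ℝ), ∀ σ > (0 : ℝ), ∀ m M : ℝ, 0 < m →
    ∃ O D : Set E5, IsConvexEntropySystem O (hsFlux σ) (hsEntropy σ) (hsEntropyFlux σ) ∧
      D ⊆ O ∧ IsCompact D ∧ Convex ℝ D ∧ consBox σ η₁ m M ⊆ D

/-- **S2 — periodic lift of the classical solution (calculus; size M).** For `σ > 0`, a box
`(η, m, M)` with `0 < m`, a POSITIVE horizon `0 < T`, any open `O` on which the hard-sphere system is a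
Dafermos system and which contains `consBox σ η m M`: the lift `slabLift T ρ θ u` of a classical
solution `IsHardSphereEulerSolution σ T ρ u θ` valued in the box is an `IsClassicalSolution O (hsFlux σ)
T` on `ℝ³` (a weak solution with its own `t = 0` slice as datum, Lipschitz on every
`[0,T'] × B̄(0,R)`, `T' < T`). Why plausibly true: `(t,y) ↦ (ρ,u,θ)(t, proj y)` is `C^∞` on
`[0,T) × ℝ³` by the very definition of `Torus.IsSmoothSpaceTimeOn` (smoothness of `stLift`), `cons` is
polynomial, so the lift is `C¹` on the slab, hence Lipschitz on the convex compact boxes and bounded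
with values in `consBox ⊆ O`; the pointwise torus equations (`mass`, `momentum`, `energy`, one-sided
`timeDerivWithin (Ico 0 T)` = two-sided for `t > 0`) say `∂ₜU + Σ_α ∂_α G_α(U) = 0` on `(0,T) × ℝ³`
because torus derivatives ARE derivatives of lifts (`Torus.partialDeriv`, `liftAt f (proj y) v =
f (proj (y + v))`) and the rows of `hsFlux ∘ cons` are `(ρu_α, ρu_αu + p e_α, (E + p)u_α)` for `ρ > 0`;
integrate by parts against a `C¹_c` test function vanishing for `t ≥ T' < T` (boundary term at `t = 0`
only). Measurability of the lift on all of `ℝ × ℝ³` holds thanks to the freeze outside `[0,T)`. Why it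
might fail: bookkeeping only — the one-sided derivative at `t = 0`, the `if` in `slabLift`, and
`G_α ∘ slabLift` measurable/locally integrable on the slab (continuity of `G_α` on `O ⊇ consBox`). Leans
on: `IsHardSphereEulerSolution`, `Torus.IsSmoothSpaceTimeOn`, `Torus.timeDerivWithin_of_mem_interior`,
`ConservationLaw.IsClassicalSolution/IsWeakSolution/IsTestFunction`, Mathlib
`Convex.lipschitzOnWith_of_nnnorm_fderivWithin_le`, `intervalIntegral.integral_deriv_mul_eq_sub`. -/
def Sig.stub_classicalLift : Prop :=
  ∀ σ > (0 : ℝ), ∀ (η m M T : ℝ), 0 < m → 0 < T → ∀ O : Set E5,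
    IsConvexEntropySystem O (hsFlux σ) (hsEntropy σ) (hsEntropyFlux σ) → consBox σ η m M ⊆ O →
    ∀ (ρ θ : ℝ → T3 → ℝ) (u : ℝ → T3 → V3), IsHardSphereEulerSolution σ T ρ u θ →
      InBox σ η m M T ρ θ u → IsClassicalSolution O (hsFlux σ) T (slabLift T ρ θ u)

/-- **S3 — periodic lift of the weak entropy solution (THE HEART; periodisation + density; size L).**
For `σ > 0`, a box with `0 < m`, `0 < T`, `O` as in S2, a boxed classical reference `(ρ,u,θ)` (only its
smooth `t = 0` slice is used) and a competitor `(ρ',u',θ')` that is jointly measurable, satisfies the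
crux's torus weak formulation with entropy inequality (`TorusWeakEntropySol`), is valued in the box and
has `t = 0` slice a.e. equal to the reference's: the lift `slabLift T ρ' θ' u'` is an
`IsWeakSolution O (hsFlux σ) T · (slabLift T ρ θ u 0)` AND `IsEntropyAdmissible (hsEntropy σ)
(hsEntropyFlux σ) T · (slabLift T ρ θ u 0)` on `ℝ³`. Why plausibly true: given a `C¹` test function
`φ` with compact support in `ℝ × ℝ³` vanishing for `t ≥ T' < T`, mollify in space–time to `φ_ε ∈ C^∞_c`
(vanishing for `t ≥ T'' < T`, `φ_ε ≥ 0` if `φ ≥ 0`), periodise `ψ_ε(t,x) = Σ_{k∈ℤ³} φ_ε(t, x̃ + k)`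
(locally finite, so `stLift ψ_ε` is smooth): the torus identities/inequality for `ψ_ε` are the `ℝ³`
ones for `φ_ε` because `volume` on `UnitAddTorus (Fin 3)` is the image of Lebesgue measure on `[0,1)³`
(`AddCircle.measurePreserving_mk`), `∫_{t>0}` and `∫_{0<t<T}` agree (the integrands vanish for
`t ≥ T''`), and the rows of `hsFlux ∘ cons`, `hsEntropy ∘ cons = H`, `hsEntropyFlux ∘ cons = Hu'` match the
crux's integrands for `ρ' ≥ m > 0`; the initial terms use `η(U₀)`/`U₀` of the REFERENCE datum, equal
a.e. to the competitor's slice (hypothesis), so the integrals agree; let `ε → 0` (fields bounded on the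
slab, `∂φ_ε → ∂φ` uniformly on a common compact support). Measurability, values in `O`, bounds and
local integrability are read off `InBox` and `consBox ⊆ O`. Why it might fail: the crux tests only
against `C^∞` functions while `IsTestFunction` is `C¹_c` — the density step needs the dominated
convergence with the junk-free integrability of every pairing (bounded measurable fields × compactly
supported continuous derivatives); the torus-measure/fundamental-domain identity for `UnitAddTorus
(Fin 3) = Fin 3 → AddCircle 1` has to be assembled from the one-dimensional Mathlib API. Leans on:
`ConservationLaw.IsWeakSolution/IsEntropyAdmissible/IsTestFunction`, Mathlib `ContDiffBump`,
`HasCompactSupport.contDiff_convolution_left`, `AddCircle.measurePreserving_mk`,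
`MeasureTheory.integral_prod`, `integral_congr_ae`, `Torus.proj`, `Torus.stLift`. -/
def Sig.stub_weakLift : Prop :=
  ∀ σ > (0 : ℝ), ∀ (η m M T : ℝ), 0 < m → 0 < T → ∀ O : Set E5,
    IsConvexEntropySystem O (hsFlux σ) (hsEntropy σ) (hsEntropyFlux σ) → consBox σ η m M ⊆ O →
    ∀ (ρ θ : ℝ → T3 → ℝ) (u : ℝ → T3 → V3), IsHardSphereEulerSolution σ T ρ u θ →
      InBox σ η m M T ρ θ u →
    ∀ (ρ' θ' : ℝ → T3 → ℝ) (u' : ℝ → T3 → V3),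
      (∀ f ∈ [ρ', θ'], Measurable (Function.uncurry f)) → Measurable (Function.uncurry u') →
      TorusWeakEntropySol σ T ρ' θ' u' → InBox σ η m M T ρ' θ' u' →
      (∀ᵐ x : T3, ρ' 0 x = ρ 0 x ∧ u' 0 x = u 0 x ∧ θ' 0 x = θ 0 x) →
      IsWeakSolution O (hsFlux σ) T (slabLift T ρ' θ' u') (slabLift T ρ θ u 0) ∧
        IsEntropyAdmissible (hsEntropy σ) (hsEntropyFlux σ) T (slabLift T ρ' θ' u') (slabLift T ρ θ u 0)

/-- **S4 — readout on the torus at every time (measure theory; size M).** For a box with `0 < m`, a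
boxed classical reference `(ρ,u,θ)` on `[0,T)` and a boxed, jointly measurable, `L¹`-time-continuous
competitor `(ρ',u',θ')`: if the two lifts agree a.e. on `(0,T) × ℝ³` (the conclusion of the tree's
Dafermos theorem), then at EVERY `t ∈ [0,T)` the primitive fields agree a.e. on `𝕋³`. Why plausibly
true: Fubini gives a full-measure set of times `s ∈ (0,T)` with `cons(ρ',u',θ')(s, proj y) =
cons(ρ,u,θ)(s, proj y)` for a.e. `y ∈ ℝ³`, hence for a.e. `x ∈ 𝕋³` (`proj` restricted to `[0,1)³` is
measure-preserving onto the torus); `cons` is injective on `ρ > 0` (`u = m/ρ`, `θ = θ(U)`), and both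
densities are `≥ m > 0`; for an arbitrary `t ∈ [0,T)` pick good times `s_n ↓ t` inside `(t,T)`: by the
`L¹(𝕋³)`-continuity of both triples within `[0,T)` (the competitor's by hypothesis, the reference's by
joint smoothness) and the triangle inequality for the genuinely integrable (bounded measurable)
distances, `∫ dist((ρ',u',θ')(t), (ρ,u,θ)(t)) = 0`, i.e. equality a.e. Vacuous for `T ≤ 0`. Why it
might fail: only through junk — every `∫ x, dist …` must be a true integral (box bounds +
measurability of slices, supplied), and the null-set transfer `ℝ³ → 𝕋³` needs the quotient-measure
identification. Leans on: Mathlib `Measure.ae_prod_iff_ae_ae`/`ae_restrict_iff`,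
`AddCircle.measurePreserving_mk`, `integral_eq_zero_iff_of_nonneg`, `tendsto_nhds_unique`,
`IsHardSphereEulerSolution` (continuity of the reference), `Torus.proj_surjective`. -/
def Sig.stub_readout : Prop :=
  ∀ (σ η m M T : ℝ), 0 < m → ∀ (ρ θ : ℝ → T3 → ℝ) (u : ℝ → T3 → V3),
    IsHardSphereEulerSolution σ T ρ u θ → InBox σ η m M T ρ θ u →
    ∀ (ρ' θ' : ℝ → T3 → ℝ) (u' : ℝ → T3 → V3),
      (∀ f ∈ [ρ', θ'], Measurable (Function.uncurry f)) → Measurable (Function.uncurry u') →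
      TimeL1Cont T ρ' θ' u' → InBox σ η m M T ρ' θ' u' →
      (∀ᵐ p : ℝ × EuclideanSpace ℝ (Fin 3), p.1 ∈ Set.Ioo 0 T →
          slabLift T ρ' θ' u' p.1 p.2 = slabLift T ρ θ u p.1 p.2) →
      ∀ t ∈ Set.Ico 0 T, ∀ᵐ x : T3, ρ' t x = ρ t x ∧ u' t x = u t x ∧ θ' t x = θ t x
-- §1-END

/-! ## §2 Stubs (registered; `sorry` only inside them) — hardest: `stub_weakLift` -/

/-- **S1 (M–L).** The hard-sphere Euler system at low packing is a Dafermos convex-entropy system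
around every dilute box. -/
theorem stub_entropyStructure : Sig.stub_entropyStructure := by
  sorry

/-- **S2 (M).** The periodic lift of a boxed classical solution is a classical solution on `ℝ³`. -/
theorem stub_classicalLift : Sig.stub_classicalLift := by
  sorry

/-- **S3 (L; the heart).** The periodic lift of the crux's torus weak entropy solution is an
admissible weak solution on `ℝ³` with the classical datum. -/
theorem stub_weakLift : Sig.stub_weakLift := by
  sorry

/-- **S4 (M).** A.e. equality of the lifts on `(0,T) × ℝ³` reads out as a.e. equality of the primitive
fields on `𝕋³` at every `t ∈ [0,T)`. -/
theorem stub_readout : Sig.stub_readout := by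
  sorry

/-! ## §3 Composition (sorry-free) -/

/-- Inside `[0,T)` the lift is the conserved state of the triple at `(t, proj y)`. -/
theorem slabLift_of_mem {T : ℝ} (ρ θ : ℝ → T3 → ℝ) (u : ℝ → T3 → V3) {s : ℝ}
    (hs : s ∈ Set.Ico 0 T) (y : E3) :
    slabLift T ρ θ u s y = cons (ρ s (Torus.proj y)) (u s (Torus.proj y)) (θ s (Torus.proj y)) :=
  if_pos hs

/-- A boxed triple lifts into `consBox` on `[0,T)`. -/
theorem slabLift_mem_consBox {σ η m M T : ℝ} {ρ θ : ℝ → T3 → ℝ} {u : ℝ → T3 → V3}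
    (hbox : InBox σ η m M T ρ θ u) {s : ℝ} (hs : s ∈ Set.Ico 0 T) (y : E3) :
    slabLift T ρ θ u s y ∈ consBox σ η m M := by
  rw [slabLift_of_mem ρ θ u hs y]
  exact ⟨_, _, _, hbox s hs (Torus.proj y), rfl⟩

/-- **The line closes the crux modulo its stubs**: `WeakStrongUniquenessHS3D` BY NAME from S1–S4.
Real content: the packing threshold is S1's `η₁`; the positive horizon `0 < T` is extracted from
`t ∈ [0,T)`; S1 supplies `consBox ⊆ D ⊆ O`, S2 and S3 the three solution predicates of the lifts, the
box hypotheses put both lifts in `D`, the TREE THEOREM `dafermos_weak_strong_uniqueness_holds`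
(Dafermos 2000 Thm 5.2.1, proved in `ConservationLawWeakStrongUniqueness.lean`) at `m = 3`, `n = 5`
identifies the lifts a.e. on `(0,T) × ℝ³`, and S4 reads the conclusion off; the crux's `let`s `W3`,
`S3`, `B3` are matched definitionally by the §0 objects. -/
theorem WeakStrongUniquenessHS3D_of (h₁ : Sig.stub_entropyStructure) (h₂ : Sig.stub_classicalLift)
    (h₃ : Sig.stub_weakLift) (h₄ : Sig.stub_readout) :
    StrongClosureWeakBV.WeakStrongUniquenessHS3D := by
  obtain ⟨η₁, hη₁, H₁⟩ := h₁
  refine ⟨η₁, hη₁, ?_⟩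
  intro σ hσ m M hm T W3' S3' B3' ρ θ u hsol hbox ρ' θ' u' hS' hbox' hinit t ht
  -- the positive horizon (the crux is vacuous at `T ≤ 0`)
  have hT : 0 < T := lt_of_le_of_lt ht.1 ht.2
  -- the crux's `let` blocks, matched definitionally by the §0 objects
  have hboxR : InBox σ η₁ m M T ρ θ u := hbox
  have hboxC : InBox σ η₁ m M T ρ' θ' u' := hbox'
  have hS : WeakEntropySol σ T ρ' θ' u' := hS'
  obtain ⟨hmeas, hmeasu, hcont, hweakT⟩ := hS
  -- S1: the Dafermos structure around the dilute box
  obtain ⟨O, D, hsys, hDO, hDc, hDconv, hBD⟩ := H₁ σ hσ m M hm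
  have hBO : consBox σ η₁ m M ⊆ O := hBD.trans hDO
  -- S2: the classical solution lifts to a classical solution on ℝ³
  have hcl : IsClassicalSolution O (hsFlux σ) T (slabLift T ρ θ u) :=
    h₂ σ hσ η₁ m M T hm hT O hsys hBO ρ θ u hsol hboxR
  -- S3: the weak entropy solution lifts to an admissible weak solution with the classical datum
  obtain ⟨hws, hadm⟩ :=
    h₃ σ hσ η₁ m M T hm hT O hsys hBO ρ θ u hsol hboxR ρ' θ' u' hmeas hmeasu hweakT hboxC hinit
  -- both lifts take values in the convex compact `D`
  have hRD : ∀ s ∈ Set.Ico 0 T, ∀ y, slabLift T ρ θ u s y ∈ D :=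
    fun s hs y => hBD (slabLift_mem_consBox hboxR hs y)
  have hCD : ∀ s ∈ Set.Ico 0 T, ∀ y, slabLift T ρ' θ' u' s y ∈ D :=
    fun s hs y => hBD (slabLift_mem_consBox hboxC hs y)
  -- Dafermos–DiPerna weak–strong uniqueness (tree theorem), `m = 3`, `n = 5`
  have hae : ∀ᵐ p : ℝ × EuclideanSpace ℝ (Fin 3), p.1 ∈ Set.Ioo 0 T →
      slabLift T ρ' θ' u' p.1 p.2 = slabLift T ρ θ u p.1 p.2 :=
    dafermos_weak_strong_uniqueness_holds 3 5 O (hsFlux σ) (hsEntropy σ) (hsEntropyFlux σ) hsys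
      D hDO hDc hDconv T hT (slabLift T ρ θ u) hcl hRD (slabLift T ρ' θ' u') hws hadm hCD
  -- S4: readout at the time `t`
  exact h₄ σ η₁ m M T hm ρ θ u hsol hboxR ρ' θ' u' hmeas hmeasu hcont hboxC hae t ht

/-- The skeleton instantiated: the crux modulo the four registered stubs. -/
theorem WeakStrongUniquenessHS3D_skeleton : StrongClosureWeakBV.WeakStrongUniquenessHS3D :=
  WeakStrongUniquenessHS3D_of stub_entropyStructure stub_classicalLift stub_weakLift stub_readout

end Summit.AtomisticToContinuum.HydrodynamicLimit.Cruxes.WeakStrongUniquenessHS3D.Birth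

end
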